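import Mathlib
import Summits.Ventures.PercRepro.TriangleCapFourBelowAssembly

/-!
# PercRepro — FOUR BELOW THE DIAGONAL AT `k = 12`: THE WINDMILL THROUGH THE MINIMUM DEGREE (p3, gen 39; part 137)

The assembly of part 127 needs `k ≥ 13` only for the windmill (three triangles through one vertex `t`), where
the crude transversal bound `|F| ≤ 2 (k − 7)` is two short at `k = 12`.  With every degree `≥ 2` the bound
improves to **`|F| ≤ 2 (k − 8)`** (`transversal_card_le_of_windmill`): a transversal partner `z ∉ W` of `t`
(`t ∼ z`, no common neighbour, `N(t) ∪ N(z) = V`) has a second neighbour `y ≠ t`, which is not adjacent to `t`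
(no common neighbour), hence lies outside `W` — so not EVERY vertex outside `W` is a transversal partner of
`t` (else `y` would be one, adjacent to `t`).  **`three_triangles_stability_four_of_windmill_of_twelve`** and
**`three_triangles_stability_four_of_twelve`** (the intersection-pattern case analysis of part 127 for
`k ≥ 12`, every degree `≥ 2`).  Axioms: standard.
-/

namespace PercRepro

namespace TriangleCap

namespace C047

open Finset

variable {V : Type*} [Fintype V] [DecidableEq V]

/-- **THE REFINED TRANSVERSAL BOUND OF THE WINDMILL:** with every degree `≥ 2`, at most `|Wᶜ| − 1` vertices
outside `W = T₁ ∪ T₂ ∪ T₃` are transversal partners of the centre `t` in either order. -/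
theorem transversal_card_le_of_windmill (D : SimpleGraph V) [DecidableRel D.Adj] (hK : K4mFree D)
    (T₁ T₂ T₃ : Finset V) (h₁ : T₁.card = 3) (h₂ : T₂.card = 3) (h₃ : T₃.card = 3) {t : V}
    (h12 : T₁ ∩ T₂ = {t}) (h13 : T₁ ∩ T₃ = {t}) (h23 : T₂ ∩ T₃ = {t})
    (hcl₁ : ∀ x ∈ T₁, ∀ y ∈ T₁, x ≠ y → D.Adj x y) (hcl₂ : ∀ x ∈ T₂, ∀ y ∈ T₂, x ≠ y → D.Adj x y)
    (hcl₃ : ∀ x ∈ T₃, ∀ y ∈ T₃, x ≠ y → D.Adj x y) (hdeg : ∀ z, 2 ≤ deg D z) :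
    ((adjPairsAll D).filter (fun p => codeg D p = 0 ∧ deficit D p = 0)).card ≤
      2 * ((T₁ ∪ T₂ ∪ T₃)ᶜ.card - 1) := by
  have hF := transversal_subset_of_windmill D hK T₁ T₂ T₃ h₁ h₂ h₃ h12 h13 h23 hcl₁ hcl₂ hcl₃
  set W : Finset V := T₁ ∪ T₂ ∪ T₃ with hW
  set F : Finset (V × V) := (adjPairsAll D).filter (fun p => codeg D p = 0 ∧ deficit D p = 0) with hFdef
  have ht1 : t ∈ T₁ := (mem_inter.mp (by rw [h12]; exact mem_singleton_self t)).1
  have ht2 : t ∈ T₂ := (mem_inter.mp (by rw [h12]; exact mem_singleton_self t)).2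
  have ht3 : t ∈ T₃ := (mem_inter.mp (by rw [h13]; exact mem_singleton_self t)).2
  -- every vertex of `W` other than `t` is adjacent to `t`
  have htW : ∀ x ∈ W, x ≠ t → D.Adj t x := by
    intro x hx hxt
    rw [hW, mem_union, mem_union] at hx
    rcases hx with (hx | hx) | hx
    · exact hcl₁ t ht1 x hx (Ne.symm hxt)
    · exact hcl₂ t ht2 x hx (Ne.symm hxt)
    · exact hcl₃ t ht3 x hx (Ne.symm hxt)
  -- a transversal partner `z` of `t` yields a vertex outside `W` that is NOT a partner
  have key : ∀ z, D.Adj t z → codeg D (t, z) = 0 → ∃ y ∈ Wᶜ, ¬ D.Adj t y := by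
    intro z hz hcod
    have hd := hdeg z
    unfold deg at hd
    obtain ⟨y, hy, hyt⟩ := exists_mem_ne (by omega : 1 < (univ.filter (fun w => D.Adj z w)).card) t
    rw [mem_filter] at hy
    have hnty : ¬ D.Adj t y := by
      intro hty
      unfold codeg at hcod
      rw [card_eq_zero, filter_eq_empty_iff] at hcod
      exact hcod (mem_univ y) ⟨hty, hy.2⟩
    refine ⟨y, ?_, hnty⟩
    rw [mem_compl]
    intro hyW
    exact hnty (htW y hyW hyt)
  set Z₁ : Finset V := Wᶜ.filter (fun z => (t, z) ∈ F) with hZ₁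
  set Z₂ : Finset V := Wᶜ.filter (fun z => (z, t) ∈ F) with hZ₂
  have hFZ : F ⊆ ({t} ×ˢ Z₁) ∪ (Z₂ ×ˢ {t}) := by
    intro p hp
    have hp' := hF hp
    rw [mem_union, mem_product, mem_product, mem_singleton, mem_singleton] at hp'
    rw [mem_union, mem_product, mem_product, mem_singleton, mem_singleton]
    rcases hp' with ⟨h1, h2⟩ | ⟨h1, h2⟩
    · left
      refine ⟨h1, ?_⟩
      rw [hZ₁, mem_filter]
      refine ⟨h2, ?_⟩
      have : p = (t, p.2) := by rw [← h1]
      rw [← this]; exact hp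
    · right
      refine ⟨?_, h2⟩
      rw [hZ₂, mem_filter]
      refine ⟨h1, ?_⟩
      have : p = (p.1, t) := by rw [← h2]
      rw [← this]; exact hp
  have hZ₁c : Z₁.card ≤ Wᶜ.card - 1 := by
    by_contra hcon
    push Not at hcon
    have hsub : Z₁ ⊆ Wᶜ := filter_subset _ _
    have hle := card_le_card hsub
    have heq : Z₁ = Wᶜ := eq_of_subset_of_card_le hsub (by omega)
    have hne : Wᶜ.Nonempty := by
      rw [← card_pos]; omega
    obtain ⟨z, hz⟩ := hne
    have hzZ : z ∈ Z₁ := by rw [heq]; exact hz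
    rw [hZ₁, mem_filter, hFdef, mem_filter] at hzZ
    obtain ⟨_, hzF, hcod, _⟩ := hzZ
    have hadj : D.Adj t z := by
      unfold adjPairsAll at hzF
      rw [mem_filter] at hzF
      exact hzF.2
    obtain ⟨y, hyW, hnty⟩ := key z hadj hcod
    have hyZ : y ∈ Z₁ := by rw [heq]; exact hyW
    rw [hZ₁, mem_filter, hFdef, mem_filter] at hyZ
    obtain ⟨_, hyF, _, _⟩ := hyZ
    unfold adjPairsAll at hyF
    rw [mem_filter] at hyF
    exact hnty hyF.2
  have hZ₂c : Z₂.card ≤ Wᶜ.card - 1 := by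
    by_contra hcon
    push Not at hcon
    have hsub : Z₂ ⊆ Wᶜ := filter_subset _ _
    have hle := card_le_card hsub
    have heq : Z₂ = Wᶜ := eq_of_subset_of_card_le hsub (by omega)
    have hne : Wᶜ.Nonempty := by
      rw [← card_pos]; omega
    obtain ⟨z, hz⟩ := hne
    have hzZ : z ∈ Z₂ := by rw [heq]; exact hz
    rw [hZ₂, mem_filter, hFdef, mem_filter] at hzZ
    obtain ⟨_, hzF, hcod, _⟩ := hzZ
    have hadj : D.Adj z t := by
      unfold adjPairsAll at hzF
      rw [mem_filter] at hzF
      exact hzF.2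
    have hcod' : codeg D (t, z) = 0 := by
      unfold codeg at hcod ⊢
      rw [card_eq_zero, filter_eq_empty_iff] at hcod ⊢
      intro x hx hxx
      exact hcod hx ⟨hxx.2, hxx.1⟩
    obtain ⟨y, hyW, hnty⟩ := key z hadj.symm hcod'
    have hyZ : y ∈ Z₂ := by rw [heq]; exact hyW
    rw [hZ₂, mem_filter, hFdef, mem_filter] at hyZ
    obtain ⟨_, hyF, _, _⟩ := hyZ
    unfold adjPairsAll at hyF
    rw [mem_filter] at hyF
    exact hnty hyF.2.symm
  calc F.card ≤ (({t} ×ˢ Z₁) ∪ (Z₂ ×ˢ {t})).card := card_le_card hFZ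
    _ ≤ ({t} ×ˢ Z₁).card + (Z₂ ×ˢ {t}).card := card_union_le _ _
    _ = Z₁.card + Z₂.card := by rw [card_product, card_product, card_singleton, one_mul, mul_one]
    _ ≤ 2 * (Wᶜ.card - 1) := by omega

/-- **FOUR BELOW THE DIAGONAL, THREE TRIANGLES THROUGH ONE VERTEX, `k ≥ 12`, EVERY DEGREE `≥ 2`.** -/
theorem three_triangles_stability_four_of_windmill_of_twelve (D : SimpleGraph V) [DecidableRel D.Adj]
    (hK : K4mFree D) (hk : 12 ≤ Fintype.card V) (hm : 6 * Fintype.card V ≤ 2 * D.edgeFinset.card + 26)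
    (hdeg : ∀ z, 2 ≤ deg D z)
    (T₁ T₂ T₃ : Finset V) (h₁ : T₁.card = 3) (h₂ : T₂.card = 3) (h₃ : T₃.card = 3) {t : V}
    (h12 : T₁ ∩ T₂ = {t}) (h13 : T₁ ∩ T₃ = {t}) (h23 : T₂ ∩ T₃ = {t})
    (hcl₁ : ∀ x ∈ T₁, ∀ y ∈ T₁, x ≠ y → D.Adj x y) (hcl₂ : ∀ x ∈ T₂, ∀ y ∈ T₂, x ≠ y → D.Adj x y)
    (hcl₃ : ∀ x ∈ T₃, ∀ y ∈ T₃, x ≠ y → D.Adj x y)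
    (hT : ∀ x y z, D.Adj x y → D.Adj x z → D.Adj y z →
      (x ∈ T₁ ∧ y ∈ T₁) ∨ (x ∈ T₂ ∧ y ∈ T₂) ∨ (x ∈ T₃ ∧ y ∈ T₃)) :
    ∑ v, deg D v * deg D v + 4 * (Fintype.card V - 5) ≤ D.edgeFinset.card * Fintype.card V := by
  have hi12 : (T₁ ∩ T₂).card ≤ 1 := by rw [h12, card_singleton]
  have hi13 : (T₁ ∩ T₃).card ≤ 1 := by rw [h13, card_singleton]
  have hi23 : (T₂ ∩ T₃).card ≤ 1 := by rw [h23, card_singleton]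
  have hT3 := card_triangles3_eq_eighteen D hK T₁ T₂ T₃ h₁ h₂ h₃ hcl₁ hcl₂ hcl₃ (ne_of_inter_card_le_one h₁ hi12)
    (ne_of_inter_card_le_one h₁ hi13) (ne_of_inter_card_le_one h₂ hi23) hT
  have hFc := transversal_card_le_of_windmill D hK T₁ T₂ T₃ h₁ h₂ h₃ h12 h13 h23 hcl₁ hcl₂ hcl₃ hdeg
  have hS : 7 ≤ (T₁ ∪ T₂ ∪ T₃).card := by
    have ht1 : t ∈ T₁ := (mem_inter.mp (by rw [h12]; exact mem_singleton_self t)).1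
    have hu : (T₁ ∪ T₂).card + (T₁ ∩ T₂).card = T₁.card + T₂.card := card_union_add_card_inter T₁ T₂
    have hu' : (T₁ ∪ T₂ ∪ T₃).card + ((T₁ ∪ T₂) ∩ T₃).card = (T₁ ∪ T₂).card + T₃.card :=
      card_union_add_card_inter (T₁ ∪ T₂) T₃
    have hi : ((T₁ ∪ T₂) ∩ T₃).card ≤ 1 := by
      rw [union_inter_distrib_right, h13, h23, union_self, card_singleton]
    rw [h12, card_singleton] at hu
    omega
  rw [card_compl] at hFc
  apply stability_four_of_transversal D hK (by omega) 3 hT3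
  omega

/-- **FOUR BELOW THE DIAGONAL, EXACTLY THREE TRIANGLES, `k ≥ 12`, EVERY DEGREE `≥ 2`:** by the intersection
pattern — the windmill through the refined transversal bound. -/
theorem three_triangles_stability_four_of_twelve (D : SimpleGraph V) [DecidableRel D.Adj] (hK : K4mFree D)
    (hk : 12 ≤ Fintype.card V) (hm : 6 * Fintype.card V ≤ 2 * D.edgeFinset.card + 26) (hdeg : ∀ z, 2 ≤ deg D z)
    {u v w a b c x y z : V}
    (huv : D.Adj u v) (huw : D.Adj u w) (hvw : D.Adj v w) (hab : D.Adj a b) (hac : D.Adj a c) (hbc : D.Adj b c)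
    (hxy : D.Adj x y) (hxz : D.Adj x z) (hyz : D.Adj y z)
    (ha : ¬ (a = u ∨ a = v ∨ a = w)) (hx : ¬ (x = u ∨ x = v ∨ x = w ∨ x = a ∨ x = b ∨ x = c))
    (hT : ∀ x' y' z', D.Adj x' y' → D.Adj x' z' → D.Adj y' z' →
      (x' ∈ ({u, v, w} : Finset V) ∧ y' ∈ ({u, v, w} : Finset V)) ∨
      (x' ∈ ({a, b, c} : Finset V) ∧ y' ∈ ({a, b, c} : Finset V)) ∨
      (x' ∈ ({x, y, z} : Finset V) ∧ y' ∈ ({x, y, z} : Finset V))) :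
    ∑ v, deg D v * deg D v + 4 * (Fintype.card V - 5) ≤ D.edgeFinset.card * Fintype.card V := by
  set T₁ : Finset V := {u, v, w} with hT₁
  set T₂ : Finset V := {a, b, c} with hT₂
  set T₃ : Finset V := {x, y, z} with hT₃
  have h₁ : T₁.card = 3 := card_triple huv.ne huw.ne hvw.ne
  have h₂ : T₂.card = 3 := card_triple hab.ne hac.ne hbc.ne
  have h₃ : T₃.card = 3 := card_triple hxy.ne hxz.ne hyz.ne
  have hcl₁ := clique_triple D huv huw hvw
  have hcl₂ := clique_triple D hab hac hbc
  have hcl₃ := clique_triple D hxy hxz hyz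
  have hx1 : ¬ (x = u ∨ x = v ∨ x = w) := fun h => hx (by tauto)
  have hx2 : ¬ (x = a ∨ x = b ∨ x = c) := fun h => hx (by tauto)
  have hi12 : (T₁ ∩ T₂).card ≤ 1 := inter_card_le_one_of_triangles D hK huv huw hvw hab hac hbc ha
  have hi13 : (T₁ ∩ T₃).card ≤ 1 := inter_card_le_one_of_triangles D hK huv huw hvw hxy hxz hyz hx1
  have hi23 : (T₂ ∩ T₃).card ≤ 1 := inter_card_le_one_of_triangles D hK hab hac hbc hxy hxz hyz hx2
  have hk10 : 10 ≤ Fintype.card V := by omega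
  rcases eq_empty_or_singleton_of_card_le_one hi12 with e12 | ⟨t, e12⟩ <;>
    rcases eq_empty_or_singleton_of_card_le_one hi13 with e13 | ⟨t', e13⟩ <;>
    rcases eq_empty_or_singleton_of_card_le_one hi23 with e23 | ⟨t'', e23⟩
  · -- disjoint
    exact three_triangles_stability_four_of_disjoint D hK hk10 hm T₁ T₂ T₃ h₁ h₂ h₃
      (disjoint_iff_inter_eq_empty.mpr e12) (disjoint_iff_inter_eq_empty.mpr e13)
      (disjoint_iff_inter_eq_empty.mpr e23) hcl₁ hcl₂ hcl₃ hT
  · -- `T₂ ∩ T₃ = {t''}` only: one shared vertex, `(T₂, T₃, T₁)`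
    exact three_triangles_stability_four_of_one_shared_of_twelve D hK (by omega) hm T₂ T₃ T₁ h₂ h₃ h₁ e23
      (disjoint_iff_inter_eq_empty.mpr (by rw [inter_comm]; exact e12))
      (disjoint_iff_inter_eq_empty.mpr (by rw [inter_comm]; exact e13)) hcl₂ hcl₃ hcl₁
      (fun x' y' z' h1 h2 h3 => by
        rcases hT x' y' z' h1 h2 h3 with h | h | h
        · exact Or.inr (Or.inr h)
        · exact Or.inl h
        · exact Or.inr (Or.inl h))
  · -- `T₁ ∩ T₃ = {t'}` only: `(T₁, T₃, T₂)`
    exact three_triangles_stability_four_of_one_shared_of_twelve D hK (by omega) hm T₁ T₃ T₂ h₁ h₃ h₂ e13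
      (disjoint_iff_inter_eq_empty.mpr e12)
      (disjoint_iff_inter_eq_empty.mpr (by rw [inter_comm]; exact e23)) hcl₁ hcl₃ hcl₂
      (fun x' y' z' h1 h2 h3 => by
        rcases hT x' y' z' h1 h2 h3 with h | h | h
        · exact Or.inl h
        · exact Or.inr (Or.inr h)
        · exact Or.inr (Or.inl h))
  · -- `T₁ ∩ T₃ = {t'}`, `T₂ ∩ T₃ = {t''}`: a path with middle `T₃`, `(T₁, T₃, T₂)`
    exact three_triangles_stability_four_of_path D hK hk10 hm T₁ T₃ T₂ h₁ h₃ h₂ e13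
      (by rw [inter_comm]; exact e23) (disjoint_iff_inter_eq_empty.mpr e12) hcl₁ hcl₃ hcl₂
      (fun x' y' z' h1 h2 h3 => by
        rcases hT x' y' z' h1 h2 h3 with h | h | h
        · exact Or.inl h
        · exact Or.inr (Or.inr h)
        · exact Or.inr (Or.inl h))
  · -- `T₁ ∩ T₂ = {t}` only: `(T₁, T₂, T₃)`
    exact three_triangles_stability_four_of_one_shared_of_twelve D hK (by omega) hm T₁ T₂ T₃ h₁ h₂ h₃ e12
      (disjoint_iff_inter_eq_empty.mpr e13) (disjoint_iff_inter_eq_empty.mpr e23) hcl₁ hcl₂ hcl₃ hT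
  · -- `T₁ ∩ T₂ = {t}`, `T₂ ∩ T₃ = {t''}`: a path with middle `T₂`
    exact three_triangles_stability_four_of_path D hK hk10 hm T₁ T₂ T₃ h₁ h₂ h₃ e12 e23
      (disjoint_iff_inter_eq_empty.mpr e13) hcl₁ hcl₂ hcl₃ hT
  · -- `T₁ ∩ T₂ = {t}`, `T₁ ∩ T₃ = {t'}`: a path with middle `T₁`, `(T₂, T₁, T₃)`
    exact three_triangles_stability_four_of_path D hK hk10 hm T₂ T₁ T₃ h₂ h₁ h₃
      (by rw [inter_comm]; exact e12) e13 (disjoint_iff_inter_eq_empty.mpr e23) hcl₂ hcl₁ hcl₃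
      (fun x' y' z' h1 h2 h3 => by
        rcases hT x' y' z' h1 h2 h3 with h | h | h
        · exact Or.inr (Or.inl h)
        · exact Or.inl h
        · exact Or.inr (Or.inr h))
  · -- three shared vertices: the windmill
    obtain ⟨htt', htt''⟩ := shared_eq_of_three D hK h₁ hcl₁ hcl₂ hcl₃ e12 e13 e23
    subst htt'
    subst htt''
    exact three_triangles_stability_four_of_windmill_of_twelve D hK hk hm hdeg T₁ T₂ T₃ h₁ h₂ h₃ e12 e13 e23
      hcl₁ hcl₂ hcl₃ hT

end C047

end TriangleCap

end PercRepro
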